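import Summits.CriticalPhenomena.PercolationContinuityZ3.Theorems.PercNearOneGluingNoHeavyLowerTailSahiC3CubeEvents
import Summits.CriticalPhenomena.PercolationContinuityZ3.Theorems.PercNearOneGluingNoHeavyLowerTailSahiStrongCubicPlus

/-!
# `NoHeavyLowerTail` (crux stmt-CriticalPhenomena-4575), master-family line P1 (gen 21): a KERNEL-CHECKABLE CERTIFICATE for the seat's
# S₃⁺ `(κ+o)(κo − e₂) ≥ e₃` on a given 3-cell system of the cube `{0,1}^m` at EVERY product measure — the checker and its soundness

Support file (seat `prim-masterthm-p1`, gen 21; `--supports stmt-CriticalPhenomena-4575`).  Four computable definitions (the certificate number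
and the digit test), no `sorry`, standard axioms.  Memo `run/shared/lean/prim/prim-masterthm/FROM-prim-masterthm-p1-g21-PRODUCT-FORM-AND-PRINCIPAL-CLASS.md` §2.

This is prim-sahi's `E₃` digit checker (`…SahiC3CubeCertCheck`: `zE3`, `checkTriple`, `checkTriple_sound`; generic engine `cubicZ` / `cubicCoef` /
`cubicForm_nonneg` / `cubicCoef_nonneg_of_digit_ge` of `…CovTransferCertAlgebra`) with a different TERM LIST.  For a sandwiched triple `(A,B,N)` of cube
events (tree `SahiDeepCore`: cells `α,β,d,κ,o`, `e₂`, `e₃`) the homogeneous strong cubic functional expands in the masses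
`a = μA, b = μB, t = μ(A∩B), k = μ(A∩B∩N)` (with `o = 1 − a − b + t`, `α = a − t`, `β = b − t`, `d = t − k`) as
  `strongCubicPlus = k − ab − ak − bk + k² + t² + a²b + ab² − 2abt − k²t + kt²`     (`strongCubicPlus_eq_poly`),
eleven signed products of three multilinear polynomials of bitmask tables (`1, A, B, A∧B, A∧B∧N`; `Σ|signs| = 12`).  So (`zS3P`, `checkS3P`,
`checkS3P_sound`) if the base-`2^σ` digit test of ONE Kronecker number passes (`12·8^m < 2^(σ−1)`), all `4^m` three-copy fibre sums (the
degree-3 tensor-Bernstein coefficients, = gen 13–20's CP3⁺ vertex values `(Φ_A+Φ_B−T)(c)` up to positive factors) are `≥ 0` and the cubic is `≥ 0` on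
`[0,1]^m`; `strongCubicPlus_nonneg_of_checkS3P`: **a passing check gives S₃⁺ — hence S₃ and the class law (`strongCubic_nonneg_of_plus`-style links in
`…SahiStrongCubicPlus`) — for that system at EVERY bias vector.**  Use: template bases (`…SahiStrongCubicPlusPrincipal`, 7 coins, `decide`), small cubes.
HONEST FRAMING: a checker; it asserts nothing about S₃⁺ in general (OPEN). [this work]
-/

namespace Summit.CriticalPhenomena.PercolationContinuityZ3.Theorems

namespace SahiS3PlusCert

open Finset OneCutCert CovTransferCert SahiC3Cube
open scoped BigOperators
open Literature.Combinatorics.Sahi2008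
open Literature.Probability.LatticeModels (prodBernoulli)
open Literature.Probability.Percolation.DecisionTree (ind)

/-! ## The certificate number of S₃⁺ and the digit test -/

/-- The certificate number of S₃⁺: with `a, b, t, k` the Kronecker numbers of `A, B, A∧B, A∧B∧N` and `F` that of the full cube,
`kFF − abF − akF − bkF + kkF + ttF + aab + abb − 2abt − kkt + ktt`. [this work] -/
def zS3P (σ m : ℕ) (F : ℤ) (A B N : ℕ) : ℤ :=
  (krT σ m (A &&& B &&& N) : ℤ) * F * F - (krT σ m A : ℤ) * (krT σ m B : ℤ) * F
    - (krT σ m A : ℤ) * (krT σ m (A &&& B &&& N) : ℤ) * F - (krT σ m B : ℤ) * (krT σ m (A &&& B &&& N) : ℤ) * F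
    + (krT σ m (A &&& B &&& N) : ℤ) * (krT σ m (A &&& B &&& N) : ℤ) * F
    + (krT σ m (A &&& B) : ℤ) * (krT σ m (A &&& B) : ℤ) * F
    + (krT σ m A : ℤ) * (krT σ m A : ℤ) * (krT σ m B : ℤ) + (krT σ m A : ℤ) * (krT σ m B : ℤ) * (krT σ m B : ℤ)
    - 2 * ((krT σ m A : ℤ) * (krT σ m B : ℤ) * (krT σ m (A &&& B) : ℤ))
    - (krT σ m (A &&& B &&& N) : ℤ) * (krT σ m (A &&& B &&& N) : ℤ) * (krT σ m (A &&& B) : ℤ)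
    + (krT σ m (A &&& B &&& N) : ℤ) * (krT σ m (A &&& B) : ℤ) * (krT σ m (A &&& B) : ℤ)

/-- The digit test with precomputed full-cube number `F`, offset `off` and its `toNat`. [this work] -/
def checkS3PW (σ m : ℕ) (F off : ℤ) (offN : ℕ) (A B N : ℕ) : Bool :=
  let Z := zS3P σ m F A B N + off
  decide (0 ≤ Z) && decide ((Z.toNat &&& offN) = offN)

/-- **The S₃⁺ certificate CHECK** of a triple of bitmasks in base `2^σ`: coefficient bound `12·8^m < 2^(σ−1)` and the AND-mask digit test. [this work] -/
def checkS3P (σ m A B N : ℕ) : Bool :=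
  decide (0 < σ) && decide (12 * 8 ^ m < 2 ^ (σ - 1)) &&
    checkS3PW σ m (krT σ m (fullN m)) (offT σ m) (offT σ m).toNat A B N

/-- The signs of the eleven cubic terms. [this work] -/
def sgn11 : Fin 11 → ℤ := ![1, -1, -1, -1, 1, 1, 1, 1, -2, -1, 1]

/-- First factors: `K, A, A, B, K, T, A, A, A, K, K` (`T = A∧B`, `K = A∧B∧N`). [this work] -/
def X11 (m A B N : ℕ) : Fin 11 → (Fin m → Bool) → ℤ :=
  ![tabZ m (A &&& B &&& N), tabZ m A, tabZ m A, tabZ m B, tabZ m (A &&& B &&& N), tabZ m (A &&& B),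
    tabZ m A, tabZ m A, tabZ m A, tabZ m (A &&& B &&& N), tabZ m (A &&& B &&& N)]

/-- Second factors: `1, B, K, K, K, T, A, B, B, K, T`. [this work] -/
def Y11 (m A B N : ℕ) : Fin 11 → (Fin m → Bool) → ℤ :=
  ![tabZ m (fullN m), tabZ m B, tabZ m (A &&& B &&& N), tabZ m (A &&& B &&& N), tabZ m (A &&& B &&& N), tabZ m (A &&& B),
    tabZ m A, tabZ m B, tabZ m B, tabZ m (A &&& B &&& N), tabZ m (A &&& B)]

/-- Third factors: `1, 1, 1, 1, 1, 1, B, B, T, T, T`. [this work] -/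
def Z11 (m A B : ℕ) : Fin 11 → (Fin m → Bool) → ℤ :=
  ![tabZ m (fullN m), tabZ m (fullN m), tabZ m (fullN m), tabZ m (fullN m), tabZ m (fullN m), tabZ m (fullN m),
    tabZ m B, tabZ m B, tabZ m (A &&& B), tabZ m (A &&& B), tabZ m (A &&& B)]

set_option maxHeartbeats 1600000 in
/-- **`checkS3P` certifies every three-copy fibre sum** of the eleven-term cubic. [this work] -/
theorem cubicCoef_nonneg_of_checkS3P {σ m A B N : ℕ} (h : checkS3P σ m A B N = true) :
    ∀ k, 0 ≤ cubicCoef sgn11 (X11 m A B N) (Y11 m A B N) (Z11 m A B) k := by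
  unfold checkS3P checkS3PW at h
  simp only [Bool.and_eq_true, decide_eq_true_eq] at h
  obtain ⟨⟨hσ, hbnd⟩, hZ, hland⟩ := h
  have hoff : offT σ m = (maskN σ (4 ^ m) : ℤ) := by
    unfold offT
    rw [off_eq σ (4 ^ m) hσ, maskN_eq_sum σ hσ, Finset.mul_sum]
  rw [hoff] at hZ hland
  rw [Int.toNat_natCast] at hland
  have hZeq : zS3P σ m (krT σ m (fullN m)) A B N = cubicZ (2 ^ σ) sgn11 (X11 m A B N) (Y11 m A B N) (Z11 m A B) := by
    unfold zS3P cubicZ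
    simp only [Fin.sum_univ_succ, Fin.sum_univ_zero, sgn11, X11, Y11, Z11, Matrix.cons_val_zero, Matrix.cons_val_succ,
      krT_eq]
    ring
  have hB : CoefBound3 sgn11 (X11 m A B N) (Y11 m A B N) (Z11 m A B) (2 ^ (σ - 1)) := by
    intro k
    have hX : ∀ j g, |X11 m A B N j g| ≤ 1 := by
      intro j g; fin_cases j <;> exact abs_tabZ_le _ _ _
    have hY : ∀ j g, |Y11 m A B N j g| ≤ 1 := by
      intro j g; fin_cases j <;> exact abs_tabZ_le _ _ _
    have hZ' : ∀ j g, |Z11 m A B j g| ≤ 1 := by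
      intro j g; fin_cases j <;> exact abs_tabZ_le _ _ _
    have h8 : ∀ j, |sgn11 j * pcoef3 (X11 m A B N j) (Y11 m A B N j) (Z11 m A B j) k| ≤ |sgn11 j| * 8 ^ m := by
      intro j
      rw [abs_mul]
      exact mul_le_mul_of_nonneg_left (abs_pcoef3_le _ _ _ (hX j) (hY j) (hZ' j) k) (abs_nonneg _)
    have hsum : |cubicCoef sgn11 (X11 m A B N) (Y11 m A B N) (Z11 m A B) k| ≤ 12 * 8 ^ m := by
      unfold cubicCoef
      calc |∑ j : Fin 11, sgn11 j * pcoef3 (X11 m A B N j) (Y11 m A B N j) (Z11 m A B j) k|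
          ≤ ∑ j : Fin 11, |sgn11 j * pcoef3 (X11 m A B N j) (Y11 m A B N j) (Z11 m A B j) k| :=
            Finset.abs_sum_le_sum_abs _ _
        _ ≤ ∑ j : Fin 11, |sgn11 j| * (8 : ℤ) ^ m := Finset.sum_le_sum fun j _ => h8 j
        _ = 12 * 8 ^ m := by
            simp only [Fin.sum_univ_succ, Fin.sum_univ_zero, sgn11, Matrix.cons_val_zero, Matrix.cons_val_succ]
            norm_num
            ring
    have hpow : (12 : ℤ) * 8 ^ m < (2 : ℕ) ^ (σ - 1) := by exact_mod_cast hbnd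
    exact lt_of_le_of_lt hsum hpow
  set M : ℕ := (zS3P σ m (krT σ m (fullN m)) A B N + maskN σ (4 ^ m)).toNat with hM
  have hMZ : (M : ℤ) = cubicZ (2 ^ σ) sgn11 (X11 m A B N) (Y11 m A B N) (Z11 m A B) +
      ∑ j : Fin (4 ^ m), (2 : ℤ) ^ (σ - 1) * (2 ^ σ) ^ (j : ℕ) := by
    rw [hM, Int.toNat_of_nonneg hZ, hZeq, maskN_eq_sum σ hσ, Fin.sum_univ_eq_sum_range
      (fun j => (2 : ℤ) ^ (σ - 1) * (2 ^ σ) ^ j) (4 ^ m)]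
  have hdig : ∀ j : ℕ, j < 4 ^ m → 2 ^ (σ - 1) ≤ digit (2 ^ σ) M j := digit_ge_of_land σ hσ (4 ^ m) M hland
  exact cubicCoef_nonneg_of_digit_ge hσ hB M hMZ hdig

/-- **Soundness of `checkS3P`**: if the digit test passes, the eleven-term cubic of the bitmask tables is nonnegative at every point of the
unit cube. [this work] -/
theorem checkS3P_sound {σ m A B N : ℕ} (h : checkS3P σ m A B N = true) {x : Fin m → ℝ} (hx : InCube x) :
    0 ≤ ML (tabR m (A &&& B &&& N)) x - ML (tabR m A) x * ML (tabR m B) x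
      - ML (tabR m A) x * ML (tabR m (A &&& B &&& N)) x - ML (tabR m B) x * ML (tabR m (A &&& B &&& N)) x
      + ML (tabR m (A &&& B &&& N)) x * ML (tabR m (A &&& B &&& N)) x + ML (tabR m (A &&& B)) x * ML (tabR m (A &&& B)) x
      + ML (tabR m A) x * ML (tabR m A) x * ML (tabR m B) x + ML (tabR m A) x * ML (tabR m B) x * ML (tabR m B) x
      - 2 * (ML (tabR m A) x * ML (tabR m B) x * ML (tabR m (A &&& B)) x)
      - ML (tabR m (A &&& B &&& N)) x * ML (tabR m (A &&& B &&& N)) x * ML (tabR m (A &&& B)) x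
      + ML (tabR m (A &&& B &&& N)) x * ML (tabR m (A &&& B)) x * ML (tabR m (A &&& B)) x := by
  have hF : 0 ≤ cubicForm sgn11 (X11 m A B N) (Y11 m A B N) (Z11 m A B) x :=
    cubicForm_nonneg (cubicCoef_nonneg_of_checkS3P h) hx
  unfold cubicForm at hF
  simp only [Fin.sum_univ_succ, Fin.sum_univ_zero, sgn11, X11, Y11, Z11, Matrix.cons_val_zero, Matrix.cons_val_succ] at hF
  have h1 : ML (fun g => ((tabZ m (fullN m) g : ℤ) : ℝ)) x = 1 := ML_fullN m x
  rw [h1] at hF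
  unfold tabR
  push_cast at hF
  linarith

/-! ## The bridge to the seat's `strongCubicPlus` -/

section Bridge

open SahiDeepCore

variable {m : ℕ}

local notation3 (prettyPrint := false) "m⟦" p ", " X "⟧" => ex (bernoulliWeight p) (ind X)

/-- **`strongCubicPlus` as a polynomial in four masses**: for a sandwiched triple,
`(κ+o)(κo−e₂)−e₃ = k − ab − ak − bk + k² + t² + a²b + ab² − 2abt − k²t + kt²` with `a = μA`, `b = μB`, `t = μ(A∩B)`, `k = μ(A∩B∩N)`. [this work] -/
theorem strongCubicPlus_eq_poly {ι : Type} [Fintype ι] (p : ι → unitInterval) {A B N : Set (Set ι)} (hAB : A \ B ⊆ N)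
    (hBA : B \ A ⊆ N) (hN : N ⊆ A ∪ B) :
    strongCubicPlus p A B N =
      m⟦p, A ∩ B ∩ N⟧ - m⟦p, A⟧ * m⟦p, B⟧ - m⟦p, A⟧ * m⟦p, A ∩ B ∩ N⟧ - m⟦p, B⟧ * m⟦p, A ∩ B ∩ N⟧
        + m⟦p, A ∩ B ∩ N⟧ * m⟦p, A ∩ B ∩ N⟧ + m⟦p, A ∩ B⟧ * m⟦p, A ∩ B⟧
        + m⟦p, A⟧ * m⟦p, A⟧ * m⟦p, B⟧ + m⟦p, A⟧ * m⟦p, B⟧ * m⟦p, B⟧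
        - 2 * (m⟦p, A⟧ * m⟦p, B⟧ * m⟦p, A ∩ B⟧)
        - m⟦p, A ∩ B ∩ N⟧ * m⟦p, A ∩ B ∩ N⟧ * m⟦p, A ∩ B⟧
        + m⟦p, A ∩ B ∩ N⟧ * m⟦p, A ∩ B⟧ * m⟦p, A ∩ B⟧ := by
  obtain ⟨hAm, hT⟩ := cells_of_sandwich p hAB hN
  have hN' : N ⊆ B ∪ A := fun ω h => (hN h).symm
  obtain ⟨hBm, hT'⟩ := cells_of_sandwich p hBA hN'
  rw [Set.inter_comm B A] at hBm hT'
  have hsum := cells_sum_eq_one p A B N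
  have ha : m⟦p, A \ B⟧ = m⟦p, A⟧ - m⟦p, A ∩ B⟧ := by linarith
  have hb : m⟦p, B \ A⟧ = m⟦p, B⟧ - m⟦p, A ∩ B⟧ := by linarith
  have hd : m⟦p, (A ∩ B) \ N⟧ = m⟦p, A ∩ B⟧ - m⟦p, A ∩ B ∩ N⟧ := by linarith
  have ho : m⟦p, (A ∪ B)ᶜ⟧ = 1 - m⟦p, A⟧ - m⟦p, B⟧ + m⟦p, A ∩ B⟧ := by linarith
  simp only [strongCubicPlus]
  rw [ha, hb, hd, ho]
  ring

/-- **A passing `checkS3P` gives S₃⁺ for the cube system at every product measure.** [this work] -/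
theorem strongCubicPlus_nonneg_of_checkS3P {σ : ℕ} (p : Fin m → unitInterval) {A B N : Set (Set (Fin m))} (hAB : A \ B ⊆ N)
    (hBA : B \ A ⊆ N) (hN : N ⊆ A ∪ B) (h : checkS3P σ m (encA m A) (encA m B) (encA m N) = true) :
    0 ≤ strongCubicPlus p A B N := by
  classical
  have hx : InCube (fun i => (p i : ℝ)) := fun i => ⟨(p i).2.1, (p i).2.2⟩
  have key := checkS3P_sound h hx
  have e : ∀ X : Set (Set (Fin m)), m⟦p, X⟧ = ML (tabR m (encA m X)) (fun i => (p i : ℝ)) := fun X => by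
    rw [ex_bernoulliWeight_ind]; exact real_eq_ML_cube p X
  rw [strongCubicPlus_eq_poly p hAB hBA hN, e, e, e, e]
  simp only [tabR_encA_inter, tabR_land] at key ⊢
  exact key

end Bridge

end SahiS3PlusCert

end Summit.CriticalPhenomena.PercolationContinuityZ3.Theorems
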